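import Literature.NumberTheory.Automorphic.UnitaryGroupSplitPlace
import Literature.NumberTheory.Automorphic.LocalUnitaryGroupCongr
import Literature.NumberTheory.Rogawski1990.LocalTransfer
import HarnessLib

/-!
# At a SPLIT place stable conjugacy IS conjugacy in `U(H)(L⁺_v)`: the local stable orbital integral is a single orbital integral
(Rogawski 1990 §3.1 p. 19, §4.1 p. 40, §14.2 p. 232 «for `v ∈ S ∪ S₀` stable conjugacy coincides with conjugacy»; Mok 2014 §1
«for `v` split `U(N)(F_v) ≅ GL_N(E_w)`»)

Topic `NumberTheory/Automorphic`; namespace `Literature.NumberTheory.Automorphic.UnitaryGroup`.  THEOREMS ONLY (no definition, no instance,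
no named fact, no `sorry`).  Written for the cell `pub/hodgecm-mathlib` (ENGINE T1): ★ `Rogawski1990/LocalTransfer` consumes the hypothesis
`∀ δ, IsStablyConj σ H γ δ → IsConj γ δ` («stable conjugacy coincides with conjugacy», ★ `stableOrbitalIntegral_eq_of_forall_isConj`) but the tree
never discharged it at a finite place.  At a place `v` of `F` that SPLITS in `E` (`w ∣ v` with `c w ≠ w`) the projection `u ↦ u_w` is an
isomorphism `U(J)(F_v) ≃ₜ* GL_N(E_w)` (★ `localSplitEquiv`), so conjugacy in the ambient `GL_N(E ⊗ F_v) = GL_N(∏_{w∣v} E_w)` — stable conjugacy —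
already gives conjugacy in `U(J)(F_v)`: the stable class of EVERY element (regular or not) is a single conjugacy class.

* `coe_localSplitEquiv_apply` — the projection on matrices (`(u : GL_N(∏_w E_w)).map (eval w)`);
* **`isConj_of_exists_conj_of_split`** — (`E/F` quadratic, `c ≠ 1`, `J` `c`-hermitian, invertible at `w`, `c w ≠ w`) if `g γ g⁻¹ = δ` for some
  `g ∈ GL_N(E ⊗ F_v)` then `γ`, `δ ∈ U(J)(F_v)` are conjugate in `U(J)(F_v)`;
* (CM, `H` hermitian with `det H ≠ 0`) **`isConj_of_isStablyConj_of_split`** on `(cmDatum L N H).Local v` in the currency ★ `IsStablyConj (c ⊗ 1) H_v`;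
  `forall_isStablyConj_imp_isConj_of_split`; **`localStableOrbitalIntegral_eq_classOrbitalIntegral_of_split`** — `Φ^st(γ, f_v) = Φ([γ], f_v)` at a
  split place for EVERY `γ`, every family of orbital measures and every `f_v` (★ `stableOrbitalIntegral_eq_of_forall_isConj`).

## References
* J. Rogawski, *Automorphic Representations of Unitary Groups in Three Variables* (1990), §3.1 p. 19, §4.1 p. 40, §14.2 p. 232 [Rogawski1990].
* C. P. Mok, *Endoscopic classification of representations of quasi-split unitary groups*, Mem. AMS 235 (2015), §1 Notation p. 5 [Mok2014].
-/

noncomputable section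

open NumberField IsDedekindDomain
open scoped Matrix MatrixGroups

namespace Literature.NumberTheory.Automorphic

namespace UnitaryGroup

open Literature.NumberTheory.Rogawski1990

/-! ## §1 Split places: ambient conjugacy ⇒ conjugacy in `U(J)(F_v)` -/

section Split

variable {F E : Type} [Field F] [NumberField F] [Field E] [NumberField E] [Algebra F E] [Algebra.IsQuadraticExtension F E]
  (c : E ≃ₐ[F] E) {N : ℕ} (J : Matrix (Fin N) (Fin N) E) {v : HeightOneSpectrum (𝓞 F)}

/-- The split-place isomorphism on matrices: `localSplitEquiv u` is the `w`-component of `u`, i.e. `u.map (eval w)`. [cite: Mok2014, §1 Notation p. 5] -/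
theorem coe_localSplitEquiv_apply (hc : c ≠ 1) (hJ : (J.map c)ᵀ = J) (w : PlacesOver E v) (hw : c • w.1 ≠ w.1)
    (hJw : IsUnit (placeForm J w.1)) (u : «local» E c N J v) :
    ((localSplitEquiv c J hc hJ w hw hJw u : GL (Fin N) (w.1.adicCompletion E)) : Matrix (Fin N) (Fin N) (w.1.adicCompletion E)) =
      ((u : GL (Fin N) (LocalRing E v)) : Matrix (Fin N) (Fin N) (LocalRing E v)).map
        (Pi.evalRingHom (fun w : PlacesOver E v => w.1.adicCompletion E) w) :=
  rfl

/-- `localSplitEquiv u = (localGLPiEquiv u)_w` as elements of `GL_N(E_w)`. [cite: Mok2014, §1 Notation p. 5] -/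
theorem localSplitEquiv_apply_eq (hc : c ≠ 1) (hJ : (J.map c)ᵀ = J) (w : PlacesOver E v) (hw : c • w.1 ≠ w.1)
    (hJw : IsUnit (placeForm J w.1)) (u : «local» E c N J v) :
    localSplitEquiv c J hc hJ w hw hJw u = localGLPiEquiv E N v (u : GL (Fin N) (LocalRing E v)) w :=
  rfl

/-- **At a split place, conjugacy in the ambient `GL_N(E ⊗ F_v)` implies conjugacy in `U(J)(F_v)`** — so every stable class of `U(J)(F_v)`
is a single conjugacy class there (`u ↦ u_w : U(J)(F_v) ≃ GL_N(E_w)` is a group isomorphism, ★ `localSplitEquiv`, and `g γ g⁻¹ = δ` projects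
to `g_w γ_w g_w⁻¹ = δ_w`). [cite: Rogawski1990, §3.1 p. 19] [cite: Mok2014, §1 Notation p. 5] -/
theorem isConj_of_exists_conj_of_split (hc : c ≠ 1) (hJ : (J.map c)ᵀ = J) (w : PlacesOver E v) (hw : c • w.1 ≠ w.1)
    (hJw : IsUnit (placeForm J w.1)) (γ δ : «local» E c N J v)
    (h : ∃ g : GL (Fin N) (LocalRing E v), g * (γ : GL (Fin N) (LocalRing E v)) * g⁻¹ = δ) : IsConj γ δ := by
  obtain ⟨g, hg⟩ := h
  set e := localSplitEquiv c J hc hJ w hw hJw with he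
  set gw : GL (Fin N) (w.1.adicCompletion E) := localGLPiEquiv E N v g w with hgw
  have hconj : gw * e γ * gw⁻¹ = e δ := by
    rw [localSplitEquiv_apply_eq, localSplitEquiv_apply_eq]
    have h1 := congrArg (fun x : GL (Fin N) (LocalRing E v) => localGLPiEquiv E N v x w) hg
    simpa only [map_mul, map_inv, Pi.mul_apply, Pi.inv_apply] using h1
  rw [isConj_iff]
  refine ⟨e.symm gw, e.injective ?_⟩
  rw [map_mul, map_mul, map_inv, ContinuousMulEquiv.apply_symm_apply, hconj]

end Split

/-! ## §2 The CM dress: `IsStablyConj ⇒ IsConj` at split places; `Φ^st = Φ` there -/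

section CM

variable (L : Type) [Field L] [NumberField L] [IsCMField L] (N : ℕ) (H : Matrix (Fin N) (Fin N) L)
  {v : HeightOneSpectrum (𝓞 ↥(maximalRealSubfield L))}

/-- **CM split places: stably conjugate elements of `U(H)(L⁺_v)` are conjugate** (★ `IsStablyConj (c ⊗ 1) H_v` = conjugacy in
`GL_N(∏_{w∣v} L_w)`; `H` hermitian with `det H ≠ 0`; `w ∣ v` with `w̄ ≠ w`). [cite: Rogawski1990, §3.1 p. 19] -/
theorem isConj_of_isStablyConj_of_split (hH : (H.map (cmConjRingHom L))ᵀ = H) (hdet : H.det ≠ 0) (w : PlacesOver L v)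
    (hw : IsCMField.complexConj L • w.1 ≠ w.1) (γ δ : (cmDatum L N H).Local v)
    (h : IsStablyConj (conjLocal L (IsCMField.complexConj L) v) ((adelicForm L N H).map (adeleToLocal L v)) γ δ) : IsConj γ δ :=
  isConj_of_exists_conj_of_split (IsCMField.complexConj L) H (IsCMField.complexConj_ne_one L)
    ((map_cmConjRingHom_eq_map_complexConj L H) ▸ hH) w hw (isUnit_placeForm_of_isUnit_det (Ne.isUnit hdet) w.1) γ δ
    (isStablyConj_iff.1 h)

/-- At a split place the hypothesis «stable conjugacy coincides with conjugacy» of ★ `stableOrbitalIntegral_eq_of_forall_isConj` holds for EVERY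
`γ ∈ U(H)(L⁺_v)`. [cite: Rogawski1990, §14.2 p. 232] -/
theorem forall_isStablyConj_imp_isConj_of_split (hH : (H.map (cmConjRingHom L))ᵀ = H) (hdet : H.det ≠ 0) (w : PlacesOver L v)
    (hw : IsCMField.complexConj L • w.1 ≠ w.1) (γ : (cmDatum L N H).Local v) :
    ∀ δ : (cmDatum L N H).Local v,
      IsStablyConj (conjLocal L (IsCMField.complexConj L) v) ((adelicForm L N H).map (adeleToLocal L v)) γ δ → IsConj γ δ :=
  fun δ h => isConj_of_isStablyConj_of_split L N H hH hdet w hw γ δ h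

/-- **`Φ^st(γ, f_v) = Φ([γ], f_v)` at a split place**, for every `γ ∈ U(H)(L⁺_v)`, every family of orbital measures and every `f_v` (★
`localStableOrbitalIntegral`, ★ `stableOrbitalIntegral_eq_of_forall_isConj`). [cite: Rogawski1990, §14.2 p. 232] [cite: Rogawski1990, §4.1 (4.1.1) p. 40] -/
theorem localStableOrbitalIntegral_eq_classOrbitalIntegral_of_split (hH : (H.map (cmConjRingHom L))ᵀ = H) (hdet : H.det ≠ 0)
    (w : PlacesOver L v) (hw : IsCMField.complexConj L • w.1 ≠ w.1)
    [∀ γ' : (cmDatum L N H).Local v,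
      MeasurableSpace ((cmDatum L N H).Local v ⧸ Subgroup.centralizer ({γ'} : Set ((cmDatum L N H).Local v)))]
    (m : OrbitalMeasureFamily ((cmDatum L N H).Local v)) (f : (cmDatum L N H).Local v → ℂ) (γ : (cmDatum L N H).Local v) :
    localStableOrbitalIntegral L N H v m f γ = classOrbitalIntegral m f (ConjClasses.mk γ) := by
  have hset : {c : ConjClasses ((cmDatum L N H).Local v) |
      IsStablyConj (conjLocal L (IsCMField.complexConj L) v) ((adelicForm L N H).map (adeleToLocal L v)) γ (Quotient.out c)} =
      {ConjClasses.mk γ} := by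
    ext c
    simp only [Set.mem_setOf_eq, Set.mem_singleton_iff]
    constructor
    · intro hc
      have h1 : ConjClasses.mk γ = ConjClasses.mk (Quotient.out c) :=
        ConjClasses.mk_eq_mk_iff_isConj.2 (isConj_of_isStablyConj_of_split L N H hH hdet w hw γ _ hc)
      rw [h1]
      exact (Quotient.out_eq c).symm
    · rintro rfl
      have h2 : ConjClasses.mk (Quotient.out (ConjClasses.mk γ)) = ConjClasses.mk γ := Quotient.out_eq _
      exact isStablyConj_of_isConj (ConjClasses.mk_eq_mk_iff_isConj.1 h2).symm
  rw [localStableOrbitalIntegral, stableOrbitalIntegralRel_def]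
  exact (finsum_mem_congr hset fun _ _ => rfl).trans finsum_mem_singleton

end CM

end UnitaryGroup

end Literature.NumberTheory.Automorphic

end
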